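import Mathlib
import HarnessLib

/-!
# Cone Fourier analysis on `F^m` for families of punctured lines

Topic `Literature/Computability/AlgebraicComplexity` (sub-namespace `LineSTPP`): the generic,
STPP-free half of an elementary Fourier ("cone") bound for families of punctured-line triples
`(F^× a_i, F^× b_i, F^× c_i)` in `F^m` over a finite field `F`, `q = |F|` — used (with
`LineSTPPPatterns.lean`) by the refutation of the route crux `AlgebraicSTPPDichotomy.ExactLineDesign`
(`Summits/MatrixMultiplication/MatrixMultiplication/Theorems/…ExactLineDesignRefutation.lean`) to show
that STPP families of punctured lines (Cohn–Kleinberg–Szegedy–Umans 2005, Def. 5.1) have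
`O(q^{m-5/2})` blocks, a power `q^{1/2}` below the packing bound
(Blasiak–Church–Cohn–Grochow–Naslund–Sawin–Umans 2017, Lemma 2.4).  Everything here is standard
finite Fourier analysis written "parametrised" (sums over unit parameters instead of set unions):

* a primitive complex additive character `ψ` of a finite field (trace to `ZMod p`, then
  `ZMod.stdAddChar`; Mathlib has the cyclotomic-valued `FiniteField.primitiveChar`, we want values
  in `ℂ`) and orthogonality on `F^m`: `Σ_ξ ψ(ξ ⬝ v) = q^m [v = 0]` (`sum_dotProduct_eq`);
* the unit sum `g(w) = Σ_{t ∈ Fˣ} ψ(t w) = q[w = 0] - 1` (`gR`, `sum_units_eq_gR`) and the master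
  identity `Σ_ξ Π_l g(ξ ⬝ u_l) = q^m · #{t ∈ (Fˣ)^L : Σ_l t_l u_l = 0}` (`sum_prod_gR`);
* block sums `F_{uv}(ξ) = Σ_i g(ξ ⬝ u_i) g(ξ ⬝ v_i)` (`FX`) with the triple and square identities
  `Σ_ξ F_{ab} F_{bc} F_{ca} = q^m · #{(i,j,k,t) : t₀a_i+t₁b_i+t₂b_j+t₃c_j+t₄c_k+t₅a_k = 0}`,
  `Σ_ξ F_{uv}² = q^m · #{(i,i',t) : t₀u_i+t₁v_i+t₂u_{i'}+t₃v_{i'} = 0}` (`sum_FFF`, `sum_FF`);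
* counting lemmas turning "all solutions are diagonal" into `≤ N (q-1)^3`, `≤ N (q-1)^2`
  (`sum_card6_le`, `sum_card4_le`) and the pointwise bound `|F_{uv}(ξ)| ≤ (q-1)² K + (q-1) N`
  (`abs_FX_le`).

Not here: anything about the STPP (see `LineSTPPPatterns.lean`) and the final inequality
`N² (q-1)⁴ ≤ q^m (q-1) + q^{2m-1} + q^m (q-1) N` (assembled in the refutation file from these pieces:
split off `ξ = 0` in the triple identity and apply Cauchy–Schwarz with the square identities and the
pointwise bound).

## References
* H. Cohn, R. Kleinberg, B. Szegedy, C. Umans, *Group-theoretic algorithms for matrix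
  multiplication*, FOCS 2005, arXiv:math/0511460, Def. 5.1. [CohnKleinbergSzegedyUmans2005]
* J. Blasiak, T. Church, H. Cohn, J. A. Grochow, E. Naslund, W. F. Sawin, C. Umans, *On cap sets and
  the group-theoretic approach to matrix multiplication*, Discrete Analysis 2017:3, Lemma 2.4.
  [BlasiakChurchCohnGrochowNaslundSawinUmans2017]
-/

open Finset Matrix

namespace Literature.Computability.AlgebraicComplexity.LineSTPP

section AddCharacters

variable {F : Type*} [Field F] [Fintype F]

/-- A finite field has a primitive complex additive character
(trace to the prime field, then the standard character of `ZMod p`). [folklore] -/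
theorem exists_addChar_isPrimitive : ∃ ψ : AddChar F ℂ, ψ.IsPrimitive := by
  classical
  let p := ringChar F
  haveI hp : Fact p.Prime := ⟨CharP.char_is_prime F _⟩
  letI : Algebra (ZMod p) F := ZMod.algebra _ _
  let ψ : AddChar F ℂ :=
    (ZMod.stdAddChar (N := p)).compAddMonoidHom (Algebra.trace (ZMod p) F).toAddMonoidHom
  have hψ : ψ ≠ 1 := by
    obtain ⟨a, ha⟩ := FiniteField.trace_to_zmod_nondegenerate F one_ne_zero
    rw [one_mul] at ha
    exact AddChar.ne_one_iff.2
      ⟨a, fun hf => ha <| ((ZMod.isPrimitive_stdAddChar p).zmod_char_eq_one_iff p _).mp hf⟩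
  exact ⟨ψ, AddChar.IsPrimitive.of_ne_one hψ⟩

variable (ψ : AddChar F ℂ)

omit [Fintype F] in
/-- An additive character turns sums into products. [folklore] -/
theorem map_sum_eq_prod {ι : Type*} (s : Finset ι) (x : ι → F) :
    ψ (∑ i ∈ s, x i) = ∏ i ∈ s, ψ (x i) := by
  classical
  induction s using Finset.induction_on with
  | empty => simp
  | insert a s ha ih => rw [Finset.sum_insert ha, Finset.prod_insert ha, AddChar.map_add_eq_mul, ih]

variable [DecidableEq F]

/-- Orthogonality of characters on `F^m`: `Σ_ξ ψ(ξ ⬝ v) = q^m [v = 0]`. [folklore] -/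
theorem sum_dotProduct_eq (hψ : ψ.IsPrimitive) {m : ℕ} (v : Fin m → F) :
    ∑ ξ : Fin m → F, ψ (ξ ⬝ᵥ v) = if v = 0 then ((Fintype.card F : ℂ) ^ m) else 0 := by
  split_ifs with hv
  · subst hv
    simp only [dotProduct_zero, AddChar.map_zero_eq_one, Finset.sum_const, Finset.card_univ,
      Fintype.card_pi, Finset.prod_const, Fintype.card_fin, nsmul_eq_mul, mul_one, Nat.cast_pow]
  · obtain ⟨l, hl⟩ : ∃ l, v l ≠ 0 := by
      by_contra h
      push Not at h
      exact hv (funext h)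
    let L : (Fin m → F) →+ F :=
      { toFun := fun ξ => ξ ⬝ᵥ v
        map_zero' := zero_dotProduct v
        map_add' := fun x y => add_dotProduct x y v }
    let Ψ : AddChar (Fin m → F) ℂ := ψ.compAddMonoidHom L
    have hΨ : Ψ ≠ 1 := by
      have h1 : ψ.mulShift (v l) ≠ 1 := hψ hl
      obtain ⟨s, hs⟩ := AddChar.ne_one_iff.1 h1
      refine AddChar.ne_one_iff.2 ⟨Pi.single l s, ?_⟩
      rw [AddChar.mulShift_apply] at hs
      simpa [Ψ, L, single_dotProduct, mul_comm] using hs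
    simpa [Ψ, L] using AddChar.sum_eq_zero_of_ne_one hΨ

/-- The real-valued unit sum `g(w) = q - 1` if `w = 0`, `-1` otherwise. [folklore] -/
noncomputable def gR (q : ℕ) (w : F) : ℝ := if w = 0 then (q : ℝ) - 1 else -1

/-- `Σ_{t ∈ Fˣ} ψ(t w) = g(w)`. [folklore] -/
theorem sum_units_eq_gR (hψ : ψ.IsPrimitive) (w : F) :
    ∑ t : Fˣ, ψ (↑t * w) = ((gR (Fintype.card F) w : ℝ) : ℂ) := by
  have hall : ∑ x : F, ψ (x * w) = if w = 0 then (Fintype.card F : ℂ) else 0 := by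
    rw [AddChar.sum_mulShift w hψ]; split_ifs <;> simp
  have hsplit : ∑ x : F, ψ (x * w) = ψ (0 * w) + ∑ x ∈ univ.erase (0 : F), ψ (x * w) :=
    (Finset.add_sum_erase _ _ (Finset.mem_univ _)).symm
  have hunits : ∑ x ∈ univ.erase (0 : F), ψ (x * w) = ∑ t : Fˣ, ψ (↑t * w) := by
    rw [Finset.sum_subtype (univ.erase (0 : F)) (p := fun x => x ≠ 0)
      (fun x => by simp [Finset.mem_erase])]
    exact (Fintype.sum_equiv unitsEquivNeZero (fun t : Fˣ => ψ (↑t * w))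
      (fun x => ψ (↑x * w)) (fun t => rfl)).symm
  rw [zero_mul, AddChar.map_zero_eq_one] at hsplit
  have : ∑ t : Fˣ, ψ (↑t * w) = (if w = 0 then (Fintype.card F : ℂ) else 0) - 1 := by
    rw [← hall, hsplit, hunits]; ring
  rw [this, gR]
  split_ifs <;> push_cast <;> ring

/-- Master identity: `Σ_ξ Π_l g(ξ ⬝ u_l) = q^m · #{t ∈ (Fˣ)^L : Σ_l t_l • u_l = 0}`. [folklore] -/
theorem sum_prod_gR (hψ : ψ.IsPrimitive) {m L : ℕ} (u : Fin L → Fin m → F) :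
    ∑ ξ : Fin m → F, ∏ l, ((gR (Fintype.card F) (ξ ⬝ᵥ u l) : ℝ) : ℂ) =
      (Fintype.card F : ℂ) ^ m *
        ((univ.filter fun T : Fin L → Fˣ => ∑ l, ((T l : F)) • u l = 0).card : ℂ) := by
  calc ∑ ξ : Fin m → F, ∏ l, ((gR (Fintype.card F) (ξ ⬝ᵥ u l) : ℝ) : ℂ)
      = ∑ ξ : Fin m → F, ∏ l, ∑ t : Fˣ, ψ (↑t * (ξ ⬝ᵥ u l)) := by
        refine Finset.sum_congr rfl fun ξ _ => Finset.prod_congr rfl fun l _ => ?_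
        rw [sum_units_eq_gR ψ hψ]
    _ = ∑ ξ : Fin m → F, ∑ T : Fin L → Fˣ, ∏ l, ψ (↑(T l) * (ξ ⬝ᵥ u l)) := by
        refine Finset.sum_congr rfl fun ξ _ => ?_
        rw [Finset.prod_univ_sum]
        simp only [Fintype.piFinset_univ]
    _ = ∑ ξ : Fin m → F, ∑ T : Fin L → Fˣ, ψ (ξ ⬝ᵥ ∑ l, ((T l : F)) • u l) := by
        refine Finset.sum_congr rfl fun ξ _ => Finset.sum_congr rfl fun T _ => ?_
        rw [← map_sum_eq_prod, dotProduct_sum]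
        congr 1
        refine Finset.sum_congr rfl fun l _ => ?_
        rw [dotProduct_smul, smul_eq_mul]
    _ = ∑ T : Fin L → Fˣ, ∑ ξ : Fin m → F, ψ (ξ ⬝ᵥ ∑ l, ((T l : F)) • u l) := Finset.sum_comm
    _ = ∑ T : Fin L → Fˣ,
          (if ∑ l, ((T l : F)) • u l = 0 then (Fintype.card F : ℂ) ^ m else 0) := by
        refine Finset.sum_congr rfl fun T _ => sum_dotProduct_eq ψ hψ _
    _ = _ := by
        rw [Finset.sum_ite, Finset.sum_const_zero, add_zero, Finset.sum_const, nsmul_eq_mul,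
          mul_comm]

end AddCharacters

section Sums

variable {F : Type*} [Field F] [Fintype F] [DecidableEq F] {m N : ℕ}

/-- Unit solutions of `Σ_l t_l • u_l = 0`. [folklore] -/
def solSet {L : ℕ} (u : Fin L → Fin m → F) : Finset (Fin L → Fˣ) :=
  univ.filter fun T => ∑ l, (T l : F) • u l = 0

/-- The real block sum `F_{uv}(ξ) = Σ_i g(ξ ⬝ u_i) g(ξ ⬝ v_i)`. [folklore] -/
noncomputable def FX (u v : Fin N → Fin m → F) (ξ : Fin m → F) : ℝ :=
  ∑ i, gR (Fintype.card F) (ξ ⬝ᵥ u i) * gR (Fintype.card F) (ξ ⬝ᵥ v i)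

/-- `F_{uv}(0) = N (q-1)²`. [folklore] -/
theorem FX_zero (u v : Fin N → Fin m → F) :
    FX u v 0 = N * ((Fintype.card F : ℝ) - 1) ^ 2 := by
  simp [FX, gR, sq]

/-- The triple identity `Σ_ξ F_X F_Y F_Z = q^m · T` (complex form). [folklore] -/
theorem sum_FFF_complex (ψ : AddChar F ℂ) (hψ : ψ.IsPrimitive) (a b c : Fin N → Fin m → F) :
    ∑ ξ : Fin m → F,
      (∑ i, ((gR (Fintype.card F) (ξ ⬝ᵥ a i) : ℝ) : ℂ) * ((gR (Fintype.card F) (ξ ⬝ᵥ b i) : ℝ) : ℂ)) *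
      (∑ j, ((gR (Fintype.card F) (ξ ⬝ᵥ b j) : ℝ) : ℂ) * ((gR (Fintype.card F) (ξ ⬝ᵥ c j) : ℝ) : ℂ)) *
      (∑ k, ((gR (Fintype.card F) (ξ ⬝ᵥ c k) : ℝ) : ℂ) * ((gR (Fintype.card F) (ξ ⬝ᵥ a k) : ℝ) : ℂ)) =
    (Fintype.card F : ℂ) ^ m *
      ∑ i : Fin N, ∑ j : Fin N, ∑ k : Fin N, ((solSet ![a i, b i, b j, c j, c k, a k]).card : ℂ) := by
  calc ∑ ξ : Fin m → F,
      (∑ i, ((gR (Fintype.card F) (ξ ⬝ᵥ a i) : ℝ) : ℂ) * ((gR (Fintype.card F) (ξ ⬝ᵥ b i) : ℝ) : ℂ)) *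
      (∑ j, ((gR (Fintype.card F) (ξ ⬝ᵥ b j) : ℝ) : ℂ) * ((gR (Fintype.card F) (ξ ⬝ᵥ c j) : ℝ) : ℂ)) *
      (∑ k, ((gR (Fintype.card F) (ξ ⬝ᵥ c k) : ℝ) : ℂ) * ((gR (Fintype.card F) (ξ ⬝ᵥ a k) : ℝ) : ℂ))
      = ∑ ξ : Fin m → F, ∑ i : Fin N, ∑ j : Fin N, ∑ k : Fin N,
          ∏ l, ((gR (Fintype.card F) (ξ ⬝ᵥ ![a i, b i, b j, c j, c k, a k] l) : ℝ) : ℂ) := by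
        refine Finset.sum_congr rfl fun ξ _ => ?_
        rw [Finset.sum_mul_sum, Finset.sum_mul]
        refine Finset.sum_congr rfl fun i _ => ?_
        rw [Finset.sum_mul]
        refine Finset.sum_congr rfl fun j _ => ?_
        rw [Finset.mul_sum]
        refine Finset.sum_congr rfl fun k _ => ?_
        rw [Fin.prod_univ_six]
        simp only [Matrix.cons_val]
        ring
    _ = ∑ i : Fin N, ∑ j : Fin N, ∑ k : Fin N, ∑ ξ : Fin m → F,
          ∏ l, ((gR (Fintype.card F) (ξ ⬝ᵥ ![a i, b i, b j, c j, c k, a k] l) : ℝ) : ℂ) := by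
        rw [Finset.sum_comm]
        refine Finset.sum_congr rfl fun i _ => ?_
        rw [Finset.sum_comm]
        refine Finset.sum_congr rfl fun j _ => ?_
        rw [Finset.sum_comm]
    _ = _ := by
        simp_rw [sum_prod_gR ψ hψ, ← Finset.mul_sum]
        rfl

/-- The triple identity `Σ_ξ F_X F_Y F_Z = q^m · T` (real form). [folklore] -/
theorem sum_FFF (a b c : Fin N → Fin m → F) :
    ∑ ξ : Fin m → F, FX a b ξ * FX b c ξ * FX c a ξ =
      (Fintype.card F : ℝ) ^ m *
        ((∑ i : Fin N, ∑ j : Fin N, ∑ k : Fin N, (solSet ![a i, b i, b j, c j, c k, a k]).card : ℕ) :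
          ℝ) := by
  obtain ⟨ψ, hψ⟩ := exists_addChar_isPrimitive (F := F)
  have h := sum_FFF_complex ψ hψ a b c
  apply Complex.ofReal_injective
  simp only [FX]
  push_cast
  exact h

/-- The square identity `Σ_ξ F_X² = q^m · D` (complex form). [folklore] -/
theorem sum_FF_complex (ψ : AddChar F ℂ) (hψ : ψ.IsPrimitive) (u v : Fin N → Fin m → F) :
    ∑ ξ : Fin m → F,
      (∑ i, ((gR (Fintype.card F) (ξ ⬝ᵥ u i) : ℝ) : ℂ) * ((gR (Fintype.card F) (ξ ⬝ᵥ v i) : ℝ) : ℂ)) *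
      (∑ j, ((gR (Fintype.card F) (ξ ⬝ᵥ u j) : ℝ) : ℂ) * ((gR (Fintype.card F) (ξ ⬝ᵥ v j) : ℝ) : ℂ)) =
    (Fintype.card F : ℂ) ^ m *
      ∑ i : Fin N, ∑ j : Fin N, ((solSet ![u i, v i, u j, v j]).card : ℂ) := by
  calc ∑ ξ : Fin m → F,
      (∑ i, ((gR (Fintype.card F) (ξ ⬝ᵥ u i) : ℝ) : ℂ) * ((gR (Fintype.card F) (ξ ⬝ᵥ v i) : ℝ) : ℂ)) *
      (∑ j, ((gR (Fintype.card F) (ξ ⬝ᵥ u j) : ℝ) : ℂ) * ((gR (Fintype.card F) (ξ ⬝ᵥ v j) : ℝ) : ℂ))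
      = ∑ ξ : Fin m → F, ∑ i : Fin N, ∑ j : Fin N,
          ∏ l, ((gR (Fintype.card F) (ξ ⬝ᵥ ![u i, v i, u j, v j] l) : ℝ) : ℂ) := by
        refine Finset.sum_congr rfl fun ξ _ => ?_
        rw [Finset.sum_mul_sum]
        refine Finset.sum_congr rfl fun i _ => Finset.sum_congr rfl fun j _ => ?_
        rw [Fin.prod_univ_four]
        simp only [Matrix.cons_val]
        ring
    _ = ∑ i : Fin N, ∑ j : Fin N, ∑ ξ : Fin m → F,
          ∏ l, ((gR (Fintype.card F) (ξ ⬝ᵥ ![u i, v i, u j, v j] l) : ℝ) : ℂ) := by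
        rw [Finset.sum_comm]
        refine Finset.sum_congr rfl fun i _ => ?_
        rw [Finset.sum_comm]
    _ = _ := by
        simp_rw [sum_prod_gR ψ hψ, ← Finset.mul_sum]
        rfl

/-- The square identity `Σ_ξ F_X² = q^m · D` (real form). [folklore] -/
theorem sum_FF (u v : Fin N → Fin m → F) :
    ∑ ξ : Fin m → F, FX u v ξ ^ 2 =
      (Fintype.card F : ℝ) ^ m *
        ((∑ i : Fin N, ∑ j : Fin N, (solSet ![u i, v i, u j, v j]).card : ℕ) : ℝ) := by
  obtain ⟨ψ, hψ⟩ := exists_addChar_isPrimitive (F := F)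
  have h := sum_FF_complex ψ hψ u v
  apply Complex.ofReal_injective
  simp only [FX, sq]
  push_cast
  exact h

/-- Counting the diagonal: `Σ_{i,i'} #solSet ≤ N (q-1)^2` given the two-block diagonal property. [folklore] -/
theorem sum_card4_le (u v : Fin N → Fin m → F)
    (hdiag : ∀ {i i' : Fin N} {x₀ x₁ x₂ x₃ : Fˣ},
      (x₀ : F) • u i + (x₁ : F) • v i + (x₂ : F) • u i' + (x₃ : F) • v i' = 0 →
        i = i' ∧ x₂ = -x₀ ∧ x₃ = -x₁) :
    ∑ i : Fin N, ∑ i' : Fin N, (solSet ![u i, v i, u i', v i']).card ≤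
      N * (Fintype.card F - 1) ^ 2 := by
  have hle : ∀ i i' : Fin N, (solSet ![u i, v i, u i', v i']).card ≤
      if i = i' then (Fintype.card F - 1) ^ 2 else 0 := by
    intro i i'
    split_ifs with hii
    · calc (solSet ![u i, v i, u i', v i']).card
          ≤ ((univ : Finset (Fˣ × Fˣ)).image
              fun p => (![p.1, p.2, -p.1, -p.2] : Fin 4 → Fˣ)).card := by
            refine Finset.card_le_card fun T hT => ?_
            simp only [solSet, Finset.mem_filter, Finset.mem_univ, true_and, Fin.sum_univ_four,
              Matrix.cons_val] at hT
            obtain ⟨-, h2, h3⟩ := hdiag hT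
            refine Finset.mem_image.2 ⟨(T 0, T 1), Finset.mem_univ _, ?_⟩
            funext l
            fin_cases l <;> simp [h2, h3]
        _ ≤ (univ : Finset (Fˣ × Fˣ)).card := Finset.card_image_le
        _ = (Fintype.card F - 1) ^ 2 := by
            simp [Finset.card_univ, Fintype.card_prod, Fintype.card_units, sq]
    · rw [Nat.le_zero, Finset.card_eq_zero, Finset.eq_empty_iff_forall_notMem]
      intro T hT
      simp only [solSet, Finset.mem_filter, Finset.mem_univ, true_and, Fin.sum_univ_four,
        Matrix.cons_val] at hT
      exact hii (hdiag hT).1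
  calc ∑ i : Fin N, ∑ i' : Fin N, (solSet ![u i, v i, u i', v i']).card
      ≤ ∑ i : Fin N, ∑ i' : Fin N, (if i = i' then (Fintype.card F - 1) ^ 2 else 0) :=
        Finset.sum_le_sum fun i _ => Finset.sum_le_sum fun i' _ => hle i i'
    _ = N * (Fintype.card F - 1) ^ 2 := by
        simp [Finset.sum_ite_eq]

/-- Counting the diagonal of the triple identity: `T ≤ N (q-1)^3` given the three-block diagonal
property. [folklore] -/
theorem sum_card6_le (a b c : Fin N → Fin m → F)
    (hdiag : ∀ {i j k : Fin N} {x₀ x₁ x₂ x₃ x₄ x₅ : Fˣ},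
      (x₀ : F) • a i + (x₁ : F) • b i + (x₂ : F) • b j + (x₃ : F) • c j + (x₄ : F) • c k +
          (x₅ : F) • a k = 0 →
        i = j ∧ j = k ∧ x₅ = -x₀ ∧ x₂ = -x₁ ∧ x₄ = -x₃) :
    ∑ i : Fin N, ∑ j : Fin N, ∑ k : Fin N, (solSet ![a i, b i, b j, c j, c k, a k]).card ≤
      N * (Fintype.card F - 1) ^ 3 := by
  have hle : ∀ i j k : Fin N, (solSet ![a i, b i, b j, c j, c k, a k]).card ≤
      if i = j ∧ j = k then (Fintype.card F - 1) ^ 3 else 0 := by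
    intro i j k
    split_ifs with hijk
    · calc (solSet ![a i, b i, b j, c j, c k, a k]).card
          ≤ ((univ : Finset (Fˣ × Fˣ × Fˣ)).image
              fun p => (![p.1, p.2.1, -p.2.1, p.2.2, -p.2.2, -p.1] : Fin 6 → Fˣ)).card := by
            refine Finset.card_le_card fun T hT => ?_
            simp only [solSet, Finset.mem_filter, Finset.mem_univ, true_and, Fin.sum_univ_six,
              Matrix.cons_val] at hT
            obtain ⟨-, -, h5, h2, h4⟩ := hdiag hT
            refine Finset.mem_image.2 ⟨(T 0, T 1, T 3), Finset.mem_univ _, ?_⟩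
            funext l
            fin_cases l <;> simp [h5, h2, h4]
        _ ≤ (univ : Finset (Fˣ × Fˣ × Fˣ)).card := Finset.card_image_le
        _ = (Fintype.card F - 1) ^ 3 := by
            simp [Finset.card_univ, Fintype.card_prod, Fintype.card_units]
            ring
    · rw [Nat.le_zero, Finset.card_eq_zero, Finset.eq_empty_iff_forall_notMem]
      intro T hT
      simp only [solSet, Finset.mem_filter, Finset.mem_univ, true_and, Fin.sum_univ_six,
        Matrix.cons_val] at hT
      obtain ⟨hij, hjk, -⟩ := hdiag hT
      exact hijk ⟨hij, hjk⟩
  have hinner : ∀ i : Fin N,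
      ∑ j : Fin N, ∑ k : Fin N, (if i = j ∧ j = k then (Fintype.card F - 1) ^ 3 else 0) =
        (Fintype.card F - 1) ^ 3 := by
    intro i
    rw [Finset.sum_eq_single_of_mem i (Finset.mem_univ _)]
    · rw [Finset.sum_eq_single_of_mem i (Finset.mem_univ _)]
      · simp
      · intro k _ hk
        simp [Ne.symm hk]
    · intro j _ hj
      refine Finset.sum_eq_zero fun k _ => ?_
      simp [Ne.symm hj]
  calc ∑ i : Fin N, ∑ j : Fin N, ∑ k : Fin N, (solSet ![a i, b i, b j, c j, c k, a k]).card
      ≤ ∑ i : Fin N, ∑ j : Fin N, ∑ k : Fin N,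
          (if i = j ∧ j = k then (Fintype.card F - 1) ^ 3 else 0) :=
        Finset.sum_le_sum fun i _ => Finset.sum_le_sum fun j _ => Finset.sum_le_sum fun k _ =>
          hle i j k
    _ = N * (Fintype.card F - 1) ^ 3 := by
        simp only [hinner, Finset.sum_const, Finset.card_univ, Fintype.card_fin, smul_eq_mul]

omit [Fintype F] in
/-- `|F_Z(ξ)| ≤ (q-1)^2 K(ξ) + (q-1) N`. [folklore] -/
theorem abs_FX_le (u v : Fin N → Fin m → F) (ξ : Fin m → F) [Fintype F]
    (hq : 2 ≤ Fintype.card F) :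
    |FX u v ξ| ≤ ((Fintype.card F : ℝ) - 1) ^ 2 *
        ((univ.filter fun k => ξ ⬝ᵥ u k = 0 ∧ ξ ⬝ᵥ v k = 0).card : ℝ) +
      ((Fintype.card F : ℝ) - 1) * N := by
  have hq1 : (1 : ℝ) ≤ (Fintype.card F : ℝ) - 1 := by
    have : (2 : ℝ) ≤ Fintype.card F := by exact_mod_cast hq
    linarith
  have habs : |(Fintype.card F : ℝ) - 1| = (Fintype.card F : ℝ) - 1 := abs_of_pos (by linarith)
  have habs' : |1 - (Fintype.card F : ℝ)| = (Fintype.card F : ℝ) - 1 := by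
    rw [abs_sub_comm]; exact habs
  unfold FX
  calc |∑ i, gR (Fintype.card F) (ξ ⬝ᵥ u i) * gR (Fintype.card F) (ξ ⬝ᵥ v i)|
      ≤ ∑ i, |gR (Fintype.card F) (ξ ⬝ᵥ u i) * gR (Fintype.card F) (ξ ⬝ᵥ v i)| :=
        Finset.abs_sum_le_sum_abs _ _
    _ ≤ ∑ i, (((Fintype.card F : ℝ) - 1) ^ 2 * (if ξ ⬝ᵥ u i = 0 ∧ ξ ⬝ᵥ v i = 0 then 1 else 0) +
          ((Fintype.card F : ℝ) - 1)) := by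
        refine Finset.sum_le_sum fun i _ => ?_
        by_cases h1 : ξ ⬝ᵥ u i = 0 <;> by_cases h2 : ξ ⬝ᵥ v i = 0 <;>
          simp [gR, h1, h2, abs_mul, habs, habs'] <;> nlinarith [hq1]
    _ = _ := by
        rw [Finset.sum_add_distrib, ← Finset.mul_sum, Finset.sum_boole, Finset.sum_const,
          Finset.card_univ, Fintype.card_fin, nsmul_eq_mul, mul_comm (N : ℝ)]

end Sums

end Literature.Computability.AlgebraicComplexity.LineSTPP
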